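import Mathlib.Geometry.Manifold.IsManifold.InteriorBoundary
import Mathlib.AlgebraicTopology.FundamentalGroupoid.SimplyConnected
import Literature.Geometry.Lorentzian.LeviCivita
import HarnessLib

/-!
# Nomizu's theorem: Killing fields of analytic metrics extend across simply connected manifolds

K. Nomizu, *On local and global existence of Killing vector fields*, Ann. of Math. 72 (1960)
105–120, proved that on a (connected) simply connected real-analytic Riemannian manifold every
Killing vector field defined on a connected open subset extends to a Killing field on the whole
manifold (analytic continuation of Killing fields: the pair `(Y, ∇Y)` is parallel for the connection
`∇_a(Y_b, ω_{bc}) = (ω_{ab}, R_{bca}{}^d Y_d)` on `TM ⊕ Λ²T*M`, whose monodromy is trivial on a simply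
connected base). The pseudo-Riemannian version — "all the assertions and proofs of [Nomizu] remain
valid word for word when 'Riemannian' is replaced by 'pseudo-Riemannian'" — is printed as
**Theorem 2.1 (Nomizu)** of P. T. Chruściel, *On rigidity of analytic black holes*, Comm. Math. Phys.
189 (1997) 1–7 (= arXiv:gr-qc/9610011, §2, read): *"Let `(M, g_{ab})` be a (connected) simply connected
analytic pseudo-Riemannian manifold, and suppose that there exists a Killing vector field `Y` defined
on an open connected subset `𝒪` of `M`. Then there exists a Killing vector field `Ŷ` defined on `M`
which coincides with `Y` on `𝒪`."* (Also quoted in Ionescu–Klainerman, J. Amer. Math. Soc. 26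
(2013), §1: "a classical result of Nomizu establishes such a unique extension provided that the
metric is real analytic, `M` and `O` are connected and `M` is simply connected".)

This file states that theorem as the named fact `Nomizu1960_killing_extension` over the tree's
pseudo-Riemannian vocabulary (`Literature/Geometry/Lorentzian/LeviCivita.lean`): an analytic manifold
is `[IsManifold I ω M]`, an analytic metric of any signature is a
`PseudoRiemannianMetric I ω E (TangentSpace I : M → Type _)` (its `contMDiff` field is `C^ω`), the
Levi-Civita connection is `g.leviCivita` under the standing hypothesis `[g.HasLeviCivita]`
(dischargeable: `PseudoRiemannianMetric.hasLeviCivita`), and the Killing equation at a point `x` is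
`g(∇_v Y, w) + g(v, ∇_w Y) = 0` (`g.leviCivita Y x v = ∇_v Y`, the clause of `g.IsKillingField`).
"Killing vector field defined on `𝒪`" is rendered as a global section `Y` which is `C^∞` on `𝒪` (as a
map into `TM`) and satisfies the Killing equation at every point of `𝒪` (its values off `𝒪` are
irrelevant: `∇_v Y` at `x ∈ 𝒪` only sees the germ of `Y`); the conclusion gives a global `C^∞` field
`Ŷ` satisfying the Killing equation everywhere and agreeing with `Y` on `𝒪`. Only EXISTENCE is
asserted, as printed by Chruściel (uniqueness — a Killing field vanishing on a non-empty open subset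
of a connected manifold vanishes — is standard but not part of the quoted statement); analyticity of
`Ŷ` (automatic for Killing fields of analytic metrics) is likewise not asserted.

Requested by routes `FinalStateConjecture/AnalyticityInvadesErgoregion` (support
`NomizuAcrossAnalyticDoc`) and `FinalStateConjecture/BeltLiouville` (`BeltReduction`); work item
`wi-26039`. The primary source Nomizu 1960 is not held (acquisition request acq-02952); the statement
is taken from Chruściel 1997, Thm. 2.1, which prints the pseudo-Riemannian form verbatim.

## References

* K. Nomizu, *On local and global existence of Killing vector fields*, Ann. of Math. (2) 72 (1960)
  105–120, Theorems 1–2. [`Nomizu1960`]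
* P. T. Chruściel, *On rigidity of analytic black holes*, Comm. Math. Phys. 189 (1997) 1–7,
  arXiv:gr-qc/9610011, Thm. 2.1 and the footnote preceding it. [`Chrusciel1997`]
* A. D. Ionescu, S. Klainerman, *On the local extension of Killing vector-fields in Ricci flat
  manifolds*, J. Amer. Math. Soc. 26 (2013) 563–593, arXiv:1108.3575, §1. [`IonescuKlainerman2012`]
-/

noncomputable section

open Bundle Set
open scoped Manifold ContDiff Topology

namespace Literature.Geometry.Lorentzian

namespace PseudoRiemannianMetric

/-- **Nomizu's theorem (pseudo-Riemannian form, Chruściel 1997, Thm. 2.1): Killing fields of an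
analytic metric on a simply connected analytic manifold extend from connected open subsets.** For a
real-analytic manifold `M` (model `I` on a finite-dimensional space, no boundary, Hausdorff, second
countable; `[IsManifold I ω M]`) which is simply connected (hence connected), an analytic
pseudo-Riemannian metric `g` of arbitrary signature on `TM`, an open connected `𝒪 ⊆ M` and a vector
field `Y` which is `C^∞` on `𝒪` and Killing on `𝒪` (`g(∇_v Y, w) + g(v, ∇_w Y) = 0` at every point of
`𝒪`), there is a `C^∞` vector field `Ŷ` on `M`, Killing at every point of `M`, with `Ŷ = Y` on `𝒪`.
Printed: "Let `(M, g_{ab})` be a (connected) simply connected analytic pseudo-Riemannian manifold, and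
suppose that there exists a Killing vector field `Y` defined on an open connected subset `𝒪` of `M`.
Then there exists a Killing vector field `Ŷ` defined on `M` which coincides with `Y` on `𝒪`"
(Chruściel 1997, Thm. 2.1, after Nomizu 1960 — "all the assertions and proofs of [Nomizu] remain
valid word for word when 'Riemannian' is replaced by 'pseudo-Riemannian'"). Nomizu 1960, Thms. 1–2;
Chruściel 1997, Thm. 2.1. [cite: Chrusciel1997, Thm. 2.1 (Nomizu)] -/
def Nomizu1960_killing_extension : Prop :=
  ∀ {E : Type} [NormedAddCommGroup E] [NormedSpace ℝ E] [FiniteDimensional ℝ E] {H : Type}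
    [TopologicalSpace H] (I : ModelWithCorners ℝ E H) (M : Type) [TopologicalSpace M]
    [ChartedSpace H M] [IsManifold I ω M] [BoundarylessManifold I M] [T2Space M]
    [SecondCountableTopology M] [SimplyConnectedSpace M]
    (g : PseudoRiemannianMetric I ω E (TangentSpace I : M → Type _)) [g.HasLeviCivita]
    (𝒪 : Set M) (Y : Π x : M, TangentSpace I x),
    IsOpen 𝒪 → IsConnected 𝒪 →
    ContMDiffOn I I.tangent ∞ (fun x ↦ (TotalSpace.mk' E x (Y x) : TangentBundle I M)) 𝒪 →
    (∀ x ∈ 𝒪, ∀ v w : TangentSpace I x,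
      g.val x (g.leviCivita Y x v) w + g.val x v (g.leviCivita Y x w) = 0) →
    ∃ Yhat : Π x : M, TangentSpace I x,
      ContMDiff I I.tangent ∞ (fun x ↦ (TotalSpace.mk' E x (Yhat x) : TangentBundle I M)) ∧
      (∀ (x : M) (v w : TangentSpace I x),
        g.val x (g.leviCivita Yhat x v) w + g.val x v (g.leviCivita Yhat x w) = 0) ∧
      ∀ x ∈ 𝒪, Yhat x = Y x

/-- **A globally defined Killing field is its own Nomizu extension** (sanity: the conclusion of
`Nomizu1960_killing_extension` is satisfiable with `𝒪 = M`): for a `C^∞` field Killing everywhere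
the witness `Ŷ = Y` works. [folklore] -/
theorem nomizu_extension_of_global {E : Type} [NormedAddCommGroup E] [NormedSpace ℝ E]
    {H : Type} [TopologicalSpace H] {I : ModelWithCorners ℝ E H} {M : Type} [TopologicalSpace M]
    [ChartedSpace H M] [IsManifold I ω M]
    (g : PseudoRiemannianMetric I ω E (TangentSpace I : M → Type _))
    [FiniteDimensional ℝ E] [g.HasLeviCivita] (Y : Π x : M, TangentSpace I x)
    (hY : ContMDiff I I.tangent ∞ (fun x ↦ (TotalSpace.mk' E x (Y x) : TangentBundle I M)))
    (hK : ∀ (x : M) (v w : TangentSpace I x),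
      g.val x (g.leviCivita Y x v) w + g.val x v (g.leviCivita Y x w) = 0) (𝒪 : Set M) :
    ∃ Yhat : Π x : M, TangentSpace I x,
      ContMDiff I I.tangent ∞ (fun x ↦ (TotalSpace.mk' E x (Yhat x) : TangentBundle I M)) ∧
      (∀ (x : M) (v w : TangentSpace I x),
        g.val x (g.leviCivita Yhat x v) w + g.val x v (g.leviCivita Yhat x w) = 0) ∧
      ∀ x ∈ 𝒪, Yhat x = Y x :=
  ⟨Y, hY, hK, fun _ _ ↦ rfl⟩

/-- Under Nomizu's theorem, the extension of a local Killing field of an analytic metric is a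
Killing field of `g` in the sense of the tree (`g.IsKillingField`, which for an analytic `g` also
records `C^ω` regularity) as soon as it is `C^ω`; this lemma only repackages the Killing equation
for a field already known to be `C^ω`. [folklore] -/
theorem isKillingField_of_killing_equation {E : Type} [NormedAddCommGroup E] [NormedSpace ℝ E]
    {H : Type} [TopologicalSpace H] {I : ModelWithCorners ℝ E H} {M : Type} [TopologicalSpace M]
    [ChartedSpace H M] [IsManifold I ω M]
    (g : PseudoRiemannianMetric I ω E (TangentSpace I : M → Type _))
    [FiniteDimensional ℝ E] [CompleteSpace E] [g.HasLeviCivita] {Y : Π x : M, TangentSpace I x}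
    (hY : ContMDiff I I.tangent ω (fun x ↦ (TotalSpace.mk' E x (Y x) : TangentBundle I M)))
    (hK : ∀ (x : M) (v w : TangentSpace I x),
      g.val x (g.leviCivita Y x v) w + g.val x v (g.leviCivita Y x w) = 0) :
    g.IsKillingField Y :=
  ⟨hY, hK⟩

end PseudoRiemannianMetric

end Literature.Geometry.Lorentzian

end
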